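import Literature.NumberTheory.GaloisRepresentations.PhiGammaModuleRobba
import HarnessLib

/-!
# `D_rig` over finite local (Artinian) coefficient algebras and the Bellaïche–Chenevier equivalence

Requested notion `DrigArtinian` (item `defn-DrigArtinian`; route `Langlands/SteinbergWeightVelocity`,
support `ArcJetOrthogonality`): the `(φ, Γ_F)`-module `D_rig(V_A)` of a representation
`ρ_A : Γ_F^abs → GL_n(A)` over a FINITE LOCAL `E`-algebra `A` (`A = E[ε]/ε²`, `E[X]/X^{m+1}`, …),
living over the relative Robba ring `𝓡_A(π_F) = A ⊗_E 𝓡_E(π_F)`, with its functoriality in `A`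
and, as a PREDICATE, Bellaïche–Chenevier's "deformations of `V` = deformations of the étale
`D_rig(V)`" [cite: BellaicheChenevier2009, Prop. 2.3.12 (arXiv:math/0602340 numbering)].

Printed sources.  For `F = ℚ_p` and `A` a finite-dimensional local `ℚ_p`-algebra
(`𝓡_A = 𝓡 ⊗_{ℚ_p} A`, [cite: BellaicheChenevier2009, §2.2.1–2.2.2 (arXiv:math/0602340 numbering)]):
`D_rig` is a `⊗`-equivalence between `A`-representations of `G_p` and étale `(φ, Γ)`-modules over
`𝓡_A` [cite: BellaicheChenevier2009, Prop. 2.2.6 (i) (arXiv:math/0602340 numbering)], `V` is free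
over `A` iff `D_rig(V)` is free over `𝓡_A` [cite: BellaicheChenevier2009, Lemma 2.2.7 (arXiv:math/0602340 numbering)]
(whose proof gives `D_rig(V) ⊗_A M ≅ D_rig(V ⊗_A M)`), and for the deformation functors
`X_V, X_D : 𝒞 → Set` of `V` and of `D = D_rig(V)` on the category `𝒞` of local Artinian
algebras with residue field `L` [cite: BellaicheChenevier2009, §2.3.5–2.3.6 (arXiv:math/0602340 numbering)],
"`D_rig` induces natural isomorphisms `X_V ≃ X_D` and `X_{V,𝒯} ≃ X_{D,𝒯}`"
[cite: BellaicheChenevier2009, Prop. 2.3.12 (arXiv:math/0602340 numbering)].  For a general finite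
`F = K/ℚ_p` and affinoid `A`: `V ↦ D_rig(V)` over `𝓡_A(π_K)` is functorial, fully faithful,
exact and commutes with base change in `A` [cite: KedlayaPottharstXiao2014, Thm. 2.2.17].

Rendering.  As for every other object of this story (`PhiGammaModuleData.Drig`, `charMod`,
`RelativeCharData.ofCharOver`), neither Mathlib nor this tree has Berger's `D_rig^†`, so the
rule enters as a DATUM on top of the enriched datum `𝓣 : PhiGammaModuleRobba p F E`
(`PhiGammaModuleRobba.lean`, which prescribes "a further datum (no theorem is a field); its
compatibilities … are the predicate"):

* `PhiGammaModuleRobba.DrigArtinian 𝓣`: one field `DrigOver A ρ_A : FramedPhiGammaModule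
  (𝓣.ring.baseChange A) n` for `ρ_A : FramedGaloisRep F A n`, `A` ranging over the finite local
  `E`-algebras WITH THEIR CANONICAL (`E`-module, i.e. Banach) TOPOLOGY (`[IsModuleTopology E A]`,
  [cite: BellaicheChenevier2009, §2.2.1 (arXiv:math/0602340 numbering)]: "equipped with its unique
  Banach `ℚ_p`-algebra topology") — INTENDED: `D_rig(V_A)` (`= D_rig(Res_{A/E} V_A)` with its
  `A`-action) in a chosen `𝓡_A`-basis (free by Lemma 2.2.7, `V_A` being free).
* `DrigArtinian.IsFunctorial 𝓓` (nothing asserted): (1) over `A = E`, `DrigOver E ρ ≅ Drig ρ`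
  base-changed along `𝓡 → E ⊗_E 𝓡`; (2) `DrigOver` commutes with change of coefficients
  `σ : A → B` up to isomorphism (`D_rig(V) ⊗_A B ≅ D_rig(V ⊗_A B)`); (3) a change of frame of
  `ρ_A` changes `DrigOver A ρ_A` by a change of basis; (4) `DrigOver A ρ_A` is a
  `(φ, Γ_F)`-module over `𝓡_A(π_F)`: `H_F` acts trivially and `Γ_F` continuously
  [cite: BellaicheChenevier2009, Def. 2.2.1 (arXiv:math/0602340 numbering)].
* `DrigArtinian.HasBCEquivalence 𝓓` (nothing asserted): (i) full faithfulness over `A` on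
  isomorphism classes (as `PhiGammaModuleData.Drig_injective` over `E`); (ii) every
  `(φ, Γ_F)`-module `D_A` over `𝓡_A(π_F)` lifting `D_rig(ρ)` along the augmentation `π_A : A → E`
  is `≅ DrigOver A ρ_A` for a lift `ρ_A` of `ρ` ("deformations of an étale `D` are étale",
  Lemma 2.2.5 + Prop. 2.2.6 + Lemma 2.2.7 of the source = the surjectivity in Prop. 2.3.12).
  With `IsFunctorial`, `DrigOver` then induces a BIJECTION from lifts of `ρ` over `A` up to
  `GL_n(A)`-conjugacy onto lifts of `D_rig(ρ)` over `𝓡_A(π_F)` up to isomorphism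
  (`IsFunctorial.drigOver_mem_deformationsOver` is the well-definedness, proved here).

Supporting definitions (all with bodies): transport of framed modules along a `(φ, Γ)`-equivariant
ring map `FramedPhiGammaModule.map` (+ `map_conj`, `IsIso.map`, `map_trivial`,
`IsTriangularWith.map`), its instances `baseChange` (`𝓡 → A ⊗_E 𝓡`) and `mapCoeff σ`
(`σ ⊗ 1`, e.g. reduction modulo `ε`), `mapCoeff_baseChange`; the topology of
`𝓡_A(π_F) = A ⊗_E 𝓡_E(π_F)` (`baseChangeTopology`: initial for the coordinate maps `f ⊗ 1`,
`f ∈ Hom_E(A, E)` — for `A ≅ E^m` this is `𝓡^m`), the predicates `IsCyclotomicOver`,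
`IsContinuousOver` (BC's continuity footnote to Def. 2.2.1), and the two sets of framed lifts
`FramedGaloisRep.deformationsOver A π_A ρ` (`X_V(A)` before passing to classes: `ρ_A` reducing
to `ρ` EXACTLY — every deformation `(V_A, π)` has such a frame) and
`PhiGammaModuleRobba.deformationsOver 𝓣 A π_A D` (`X_D(A)`: `(φ, Γ_F)`-modules over `𝓡_A`
whose reduction along `π_A` is `≅ D`).

## Scope and caveats

* The deformation statement is printed for `F = ℚ_p` (Bellaïche–Chenevier); for general `F` the
  same dévissage runs on [cite: KedlayaPottharstXiao2014, Thm. 2.2.17] and Kedlaya's slope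
  filtration, but no separate printed statement is cited: a route positing
  `HasBCEquivalence` for `F ≠ ℚ_p` posits that extension.  Like `HasDrigEtale`,
  `RelativeCharData.IsCompatible` and their siblings, both predicates are HYPOTHESES on data, with
  no `_holds`.
* `X_V ≃ X_D` is rendered on framed representatives and up to the coarse equivalences
  (conjugacy by all of `GL_n(A)`, isomorphism of `(φ, Γ_F)`-modules over `𝓡_A`), which is what
  the item asks; Bellaïche–Chenevier's classes also remember the identification `π` with the
  special fibre.  Tracking `π` would need `DrigOver` to commute with base change ON THE NOSE in
  frames, which no choice of bases is asserted to achieve; everything here is up to `IsIso`, as in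
  `Trianguline.lean`.  The triangulated version `X_{V,𝒯} ≃ X_{D,𝒯}` ("follows immediately",
  loc. cit.) is left to users: triangulations over `𝓡_A` are `IsTriangularWith` /
  `Triangulation` over `𝓣.ring.baseChange A` with diagonal `RelativeCharData.ofCharOver A δ_A`.
* `A ⊗_E 𝓡` is the algebraic tensor product (`PhiGammaRing.baseChange`), correct since `A/E` is
  finite; étaleness over `A` (slopes of the underlying `φ`-module over `𝓡`) is not rendered.

## References

* J. Bellaïche, G. Chenevier, *Families of Galois representations and Selmer groups*, Astérisque
  324 (2009), arXiv:math/0602340 — §2.2.1, Def. 2.2.1, Lemma 2.2.5, Prop. 2.2.6, Lemma 2.2.7,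
  §2.3.5 (the category `𝒞`, `X_D`), §2.3.6 (`X_V`, Prop. 2.3.12) (arXiv numbering;
  `lit read arxiv:math/0602340`, chunks 33–40). [BellaicheChenevier2009]
* K. S. Kedlaya, J. Pottharst, L. Xiao, *Cohomology of arithmetic families of `(φ, Γ)`-modules*,
  JAMS 27 (2014), arXiv:1203.5718 — Def. 2.2.12, Thm. 2.2.17. [KedlayaPottharstXiao2014]
* L. Berger, *Représentations `p`-adiques et équations différentielles*, Invent. Math. 148 (2002)
  (`D_rig^†`). [BergerLaurent2002]
* Y. Ding, *Simple `𝓛`-invariants for `GL_n`*, Trans. AMS 372 (2019), arXiv:1807.10862 — §3.3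
  (first-order deformations over `E[ε]/ε²`). [Ding2019SimpleL]

## Mathlib / Literature declarations used

From `Trianguline.lean`: `PhiGammaRing` (+ `phiGL`, `gammaGL`), `FramedPhiGammaModule` (+ `conj`,
`IsIso`, `trivial`, `IsTriangularWith`), `PhiGammaModuleData.Drig`; from `PhiGammaModuleRobba.lean`:
`PhiGammaRing.baseChange`, `toBaseChange`, `baseChangeMap` (+ `_frob`, `_smul`,
`baseChangeMap_toBaseChange`), `FramedPhiGammaModule.toPhiGammaModule`, `PhiGammaModule.IsContinuous`,
`PhiGammaModuleRobba`; from `GaloisRep.lean` / `ContinuousRep.lean`: `FramedGaloisRep`,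
`FramedRep.baseChange`, `FramedRep.conj`, `GaloisRep.cyclotomicCharacter`.  Mathlib:
`Matrix.GeneralLinearGroup.map`, `TensorProduct.lid`, `LinearMap.rTensor`, `IsModuleTopology`
(+ `continuous_of_linearMap`), `IsLocalRing`, `continuous_iInf_dom`, `continuous_induced_dom`.
-/

noncomputable section

namespace Literature.NumberTheory.GaloisRepresentations

open Field
open scoped TensorProduct

universe u v w v' w'

/-! ## Part 1. Transport of framed `(φ, Γ)`-modules along equivariant ring maps -/

namespace FramedPhiGammaModule

variable {Γ : Type u} [Group Γ] {E : Type v} [CommRing E] {𝓡 : PhiGammaRing.{u, v, w} Γ E}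
  {E' : Type v'} [CommRing E'] {𝓡' : PhiGammaRing.{u, v', w'} Γ E'} {n : ℕ}

section Map

variable (f : 𝓡.R →+* 𝓡'.R) (hφ : ∀ r, f (𝓡.frob r) = 𝓡'.frob (f r))
  (hγ : ∀ (γ : Γ) (r : 𝓡.R), f (γ • r) = γ • f r)

include hφ in
/-- A ring map commuting with `φ` commutes with `φ` applied entrywise to invertible matrices.
[folklore] -/
lemma map_phiGL (U : GL (Fin n) 𝓡.R) :
    Matrix.GeneralLinearGroup.map f (𝓡.phiGL n U) =
      𝓡'.phiGL n (Matrix.GeneralLinearGroup.map f U) := by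
  ext i j
  exact hφ (U i j)

include hγ in
/-- A `Γ`-equivariant ring map commutes with `γ` applied entrywise to invertible matrices.
[folklore] -/
lemma map_gammaGL (γ : Γ) (U : GL (Fin n) 𝓡.R) :
    Matrix.GeneralLinearGroup.map f (𝓡.gammaGL n γ U) =
      𝓡'.gammaGL n γ (Matrix.GeneralLinearGroup.map f U) := by
  ext i j
  exact hγ γ (U i j)

/-- **Transport of a framed `(φ, Γ)`-module along a ring map `f : R → R'` of `(φ, Γ)`-rings
commuting with `φ` and with `Γ`** (e.g. `𝓡_E → 𝓡_A = A ⊗_E 𝓡_E`, or `σ ⊗ 1 : 𝓡_A → 𝓡_B` for a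
map of coefficient algebras, in particular reduction modulo an ideal `D_A ↦ D_A ⊗_A A/I`): apply `f`
to the matrices of `φ` and of the `γ`; the cocycle and commutation rules are transported because
`f` is equivariant. [cite: BellaicheChenevier2009, §2.3.5 (arXiv:math/0602340 numbering)] -/
def map (D : FramedPhiGammaModule 𝓡 n) : FramedPhiGammaModule 𝓡' n where
  matPhi := Matrix.GeneralLinearGroup.map f D.matPhi
  matGamma γ := Matrix.GeneralLinearGroup.map f (D.matGamma γ)
  matGamma_mul γ γ' := by
    rw [D.matGamma_mul, map_mul, map_gammaGL f hγ]
  matPhi_mul γ := by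
    rw [← map_phiGL f hφ, ← map_mul, D.matPhi_mul, map_mul, map_gammaGL f hγ]

/-- The matrix of `φ` of the transported module. [folklore] -/
@[simp] lemma map_matPhi (D : FramedPhiGammaModule 𝓡 n) :
    (D.map f hφ hγ).matPhi = Matrix.GeneralLinearGroup.map f D.matPhi := rfl

/-- The matrices of `γ` of the transported module. [folklore] -/
@[simp] lemma map_matGamma (D : FramedPhiGammaModule 𝓡 n) (γ : Γ) :
    (D.map f hφ hγ).matGamma γ = Matrix.GeneralLinearGroup.map f (D.matGamma γ) := rfl

/-- Transport commutes with change of basis: `(D · U) ⊗ R' = (D ⊗ R') · f(U)`. [folklore] -/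
lemma map_conj (D : FramedPhiGammaModule 𝓡 n) (U : GL (Fin n) 𝓡.R) :
    (D.conj U).map f hφ hγ = (D.map f hφ hγ).conj (Matrix.GeneralLinearGroup.map f U) := by
  ext γ : 2
  · simp only [map_matPhi, conj_matPhi, map_mul, map_inv, map_phiGL f hφ]
  · simp only [map_matGamma, conj_matGamma, map_mul, map_inv, map_gammaGL f hγ]

/-- Isomorphic framed modules stay isomorphic after transport. [folklore] -/
lemma IsIso.map {D D' : FramedPhiGammaModule 𝓡 n} (h : D.IsIso D') :
    (D.map f hφ hγ).IsIso (D'.map f hφ hγ) := by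
  obtain ⟨U, rfl⟩ := h
  exact ⟨Matrix.GeneralLinearGroup.map f U, map_conj f hφ hγ D U⟩

/-- The trivial module is transported to the trivial module. [folklore] -/
@[simp] lemma map_trivial : (trivial 𝓡 n).map f hφ hγ = trivial 𝓡' n := by
  ext γ : 2
  · exact map_one _
  · exact map_one _

/-- Upper-triangularity with diagonal data `(a, c)` is transported to upper-triangularity with
diagonal data `(f ∘ a, f ∘ c)` (the reduction of a triangulated family is triangulated by the
reduced parameters). [folklore] -/
lemma IsTriangularWith.map {D : FramedPhiGammaModule 𝓡 n} {a : Fin n → 𝓡.R}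
    {c : Fin n → Γ → 𝓡.R} (h : D.IsTriangularWith a c) :
    (D.map f hφ hγ).IsTriangularWith (fun i => f (a i)) (fun i γ => f (c i γ)) := by
  obtain ⟨hP, hPd, hG⟩ := h
  refine ⟨fun i j hij => ?_, fun i => ?_, fun γ => ⟨fun i j hij => ?_, fun i => ?_⟩⟩
  · show f ((D.matPhi : Matrix (Fin n) (Fin n) 𝓡.R) i j) = 0
    rw [hP hij, map_zero]
  · show f ((D.matPhi : Matrix (Fin n) (Fin n) 𝓡.R) i i) = f (a i)
    rw [hPd i]
  · show f ((D.matGamma γ : Matrix (Fin n) (Fin n) 𝓡.R) i j) = 0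
    rw [(hG γ).1 hij, map_zero]
  · show f ((D.matGamma γ : Matrix (Fin n) (Fin n) 𝓡.R) i i) = f (c i γ)
    rw [(hG γ).2 i]

end Map

section Coeff

variable (A : Type v) [CommRing A] [Algebra E A] [Nontrivial (A ⊗[E] 𝓡.R)]

/-- **Base change of a framed module to the coefficient algebra `A`**: `D ↦ D ⊗_E A` over
`𝓡_A = A ⊗_E 𝓡` (matrices pushed along `r ↦ 1 ⊗ r`, `PhiGammaRing.toBaseChange`); the constant
family. [cite: KedlayaPottharstXiao2014, Def. 2.2.2, Thm. 2.2.17] -/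
def baseChange (D : FramedPhiGammaModule 𝓡 n) : FramedPhiGammaModule (𝓡.baseChange A) n :=
  D.map (𝓡.toBaseChange A) (fun r => (𝓡.baseChange_frob_toBaseChange A r).symm)
    (fun γ r => (𝓡.baseChange_smul_toBaseChange A γ r).symm)

/-- The matrix of `φ` of the base change is `1 ⊗ P`. [folklore] -/
@[simp] lemma baseChange_matPhi (D : FramedPhiGammaModule 𝓡 n) :
    (D.baseChange A).matPhi = Matrix.GeneralLinearGroup.map (𝓡.toBaseChange A) D.matPhi := rfl

/-- The matrices of `γ` of the base change are `1 ⊗ G(γ)`. [folklore] -/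
@[simp] lemma baseChange_matGamma (D : FramedPhiGammaModule 𝓡 n) (γ : Γ) :
    (D.baseChange A).matGamma γ = Matrix.GeneralLinearGroup.map (𝓡.toBaseChange A) (D.matGamma γ) :=
  rfl

variable {A} {B : Type v} [CommRing B] [Algebra E B] [Nontrivial (B ⊗[E] 𝓡.R)]

/-- **Change of coefficients along an `E`-algebra map `σ : A → B`**: `D_A ↦ D_A ⊗_{A,σ} B` over
`𝓡_B` (matrices pushed along `σ ⊗ 1`, `PhiGammaRing.baseChangeMap`); for the augmentation
`π_A : A → E` of a local `A` this is the reduction `D_A ↦ D_A ⊗_A A/𝔪_A` of a deformation.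
[cite: BellaicheChenevier2009, §2.3.5 (arXiv:math/0602340 numbering)] -/
def mapCoeff (σ : A →ₐ[E] B) (D : FramedPhiGammaModule (𝓡.baseChange A) n) :
    FramedPhiGammaModule (𝓡.baseChange B) n :=
  D.map (𝓡.baseChangeMap A σ) (𝓡.baseChangeMap_frob A σ) (𝓡.baseChangeMap_smul A σ)

/-- The matrix of `φ` after change of coefficients is `(σ ⊗ 1)(P)`. [folklore] -/
@[simp] lemma mapCoeff_matPhi (σ : A →ₐ[E] B) (D : FramedPhiGammaModule (𝓡.baseChange A) n) :
    (D.mapCoeff σ).matPhi = Matrix.GeneralLinearGroup.map (𝓡.baseChangeMap A σ) D.matPhi := rfl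

/-- The matrices of `γ` after change of coefficients are `(σ ⊗ 1)(G(γ))`. [folklore] -/
@[simp] lemma mapCoeff_matGamma (σ : A →ₐ[E] B) (D : FramedPhiGammaModule (𝓡.baseChange A) n)
    (γ : Γ) :
    (D.mapCoeff σ).matGamma γ = Matrix.GeneralLinearGroup.map (𝓡.baseChangeMap A σ) (D.matGamma γ) :=
  rfl

/-- Isomorphic modules over `𝓡_A` have isomorphic images over `𝓡_B`. [folklore] -/
lemma IsIso.mapCoeff (σ : A →ₐ[E] B) {D D' : FramedPhiGammaModule (𝓡.baseChange A) n}
    (h : D.IsIso D') : (D.mapCoeff σ).IsIso (D'.mapCoeff σ) :=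
  h.map _ _ _

variable (A) in
/-- Isomorphic modules over `𝓡` have isomorphic base changes over `𝓡_A`. [folklore] -/
lemma IsIso.baseChange {D D' : FramedPhiGammaModule 𝓡 n} (h : D.IsIso D') :
    (D.baseChange A).IsIso (D'.baseChange A) :=
  h.map _ _ _

/-- **A constant family has constant specialisations**: `(D ⊗_E A) ⊗_{A,σ} B = D ⊗_E B`
(`(σ ⊗ 1)(1 ⊗ r) = 1 ⊗ r`). [folklore] -/
lemma mapCoeff_baseChange (σ : A →ₐ[E] B) (D : FramedPhiGammaModule 𝓡 n) :
    (D.baseChange A).mapCoeff σ = D.baseChange B := by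
  refine FramedPhiGammaModule.ext ?_ (funext fun γ => ?_)
  · ext i j
    exact 𝓡.baseChangeMap_toBaseChange A σ _
  · ext i j
    exact 𝓡.baseChangeMap_toBaseChange A σ _

end Coeff

end FramedPhiGammaModule

/-! ## Part 2. `(φ, Γ_F)`-modules over `𝓡_A(π_F)` and framed deformations -/

namespace FramedGaloisRep

variable {F : Type u} [Field F] {E : Type v} [Field E] [TopologicalSpace E] [IsTopologicalRing E]

/-- **Framed deformations of `ρ : Γ_F^abs →ₜ* GL_n(E)` over `(A, π_A)`** — the representatives of
Bellaïche–Chenevier's `X_V(A)`: continuous `ρ_A : Γ_F^abs →ₜ* GL_n(A)` (`A` with its `E`-module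
topology, so that the augmentation `π_A : A → E` is automatically continuous) whose reduction
along `π_A` is `ρ` ON THE NOSE.  Every deformation `(V_A, π : V_A → V)` of loc. cit. (`V_A` free
over `A`, `π` inducing `V_A ⊗_A L ≅ V`) has such a frame: lift the basis of `V` through `π`.
Two framed deformations define the same element of `X_V(A)` iff they are conjugate by some
`g ∈ GL_n(A)` reducing to `1`. [cite: BellaicheChenevier2009, §2.3.6 (arXiv:math/0602340 numbering)] -/
def deformationsOver (A : Type v) [CommRing A] [Algebra E A] [TopologicalSpace A]
    [IsModuleTopology E A] (πA : A →ₐ[E] E) {n : ℕ} (ρ : FramedGaloisRep F E n) :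
    Set (FramedGaloisRep F A n) :=
  {ρA | ρA.baseChange (πA : A →+* E) (IsModuleTopology.continuous_of_linearMap πA.toLinearMap) = ρ}

/-- Membership in `deformationsOver`: the reduction along `π_A` is `ρ`. [folklore] -/
lemma mem_deformationsOver_iff (A : Type v) [CommRing A] [Algebra E A] [TopologicalSpace A]
    [IsModuleTopology E A] (πA : A →ₐ[E] E) {n : ℕ} (ρ : FramedGaloisRep F E n)
    (ρA : FramedGaloisRep F A n) :
    ρA ∈ deformationsOver A πA ρ ↔
      ρA.baseChange (πA : A →+* E) (IsModuleTopology.continuous_of_linearMap πA.toLinearMap) = ρ :=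
  Iff.rfl

/-- **The trivial deformation**: over `A = E` (augmentation `id`), `ρ` is a deformation of itself.
[folklore] -/
lemma mem_deformationsOver_self {n : ℕ} (ρ : FramedGaloisRep F E n) :
    ρ ∈ deformationsOver E (AlgHom.id E E) ρ := by
  refine ContinuousMonoidHom.ext fun σ => ?_
  ext i j
  rfl

end FramedGaloisRep

section Robba

variable {p : ℕ} [Fact p.Prime] {F : Type u} [Field F] [TopologicalSpace F]
  {E : Type v} [Field E] [TopologicalSpace E] [IsTopologicalRing E]

namespace PhiGammaModuleRobba

variable (𝓣 : PhiGammaModuleRobba.{u, v, w} p F E)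

section OverA

variable (A : Type v) [CommRing A] [Algebra E A] [Nontrivial (A ⊗[E] 𝓣.R)]

/-- **The topology of the relative Robba ring `𝓡_A(π_F) = A ⊗_E 𝓡_E(π_F)`**: the initial topology
for the coordinate maps `f ⊗ 1 : A ⊗_E 𝓡 → E ⊗_E 𝓡 = 𝓡`, `f ∈ Hom_E(A, E)`.  For `A` finite free
over the field `E` (any `E`-basis `(a_k)`, `A ⊗_E 𝓡 = ⊕_k a_k ⊗ 𝓡`) this is the product topology
of `𝓡^m`, i.e. the natural `A`-algebra topology of `𝓡_A` (`𝓡_A = 𝓡 ⊗_{ℚ_p} A` "equipped with its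
natural `A`-algebra topology"). A definition, registered as an instance only locally.
[cite: BellaicheChenevier2009, §2.2.2 (arXiv:math/0602340 numbering)] -/
@[reducible] def baseChangeTopology : TopologicalSpace (𝓣.ring.baseChange A).R :=
  ⨅ f : A →ₗ[E] E, TopologicalSpace.induced
    (fun x : A ⊗[E] 𝓣.R => TensorProduct.lid E 𝓣.R (LinearMap.rTensor 𝓣.R f x)) inferInstance

/-- Each coordinate map `f ⊗ 1 : 𝓡_A → 𝓡` is continuous for `baseChangeTopology`. [folklore] -/
lemma continuous_coord (f : A →ₗ[E] E) :
    @Continuous _ _ (𝓣.baseChangeTopology A) inferInstance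
      (fun x : A ⊗[E] 𝓣.R => TensorProduct.lid E 𝓣.R (LinearMap.rTensor 𝓣.R f x)) :=
  continuous_iInf_dom continuous_induced_dom

/-- A framed module over `𝓡_A(π_F)` is a **`(φ, Γ_F)`-module** when `H_F = ker χ_cyc` acts by the
identity matrices (the action of `Γ_F^abs` is through `Γ_F`; `IsCyclotomic` of
`PhiGammaModuleRobba.lean` over `A`). [cite: KedlayaPottharstXiao2014, Notation 2.2.1, Def. 2.2.12] -/
def IsCyclotomicOver {n : ℕ} (D : FramedPhiGammaModule (𝓣.ring.baseChange A) n) : Prop :=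
  ∀ σ : absoluteGaloisGroup F, GaloisRep.cyclotomicCharacter F p σ = 1 → D.matGamma σ = 1

/-- **Continuity of the `Γ`-action of a framed module over `𝓡_A(π_F)`**: the orbit maps
`σ ↦ σ(x)` on `𝓡_Aⁿ` are continuous for the Krull topology and the topology of `𝓡_A`
(`baseChangeTopology`); for a free module this is Bellaïche–Chenevier's condition that the matrix
map `γ ↦ M_e(γ) ∈ GL_d(𝓡)` in an `𝓡`-basis `e` is continuous.
[cite: BellaicheChenevier2009, Def. 2.2.1 and its footnote (arXiv:math/0602340 numbering)],
[cite: KedlayaPottharstXiao2014, Def. 2.2.12, Remark 2.2.13] -/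
def IsContinuousOver {n : ℕ} (D : FramedPhiGammaModule (𝓣.ring.baseChange A) n) : Prop :=
  letI : TopologicalSpace (𝓣.ring.baseChange A).R := 𝓣.baseChangeTopology A
  D.toPhiGammaModule.IsContinuous

/-- **Framed deformations of a `(φ, Γ_F)`-module `D` over `𝓡_E(π_F)` to `(A, π_A)`** — the
representatives of Bellaïche–Chenevier's `X_D(A)`: framed (= free with a basis) `(φ, Γ_F)`-modules
`D_A` over `𝓡_A(π_F)` (`H_F` trivial, `Γ_F` continuous; `𝓡 · φ(D_A) = D_A` is built into the
invertibility of `matPhi`) whose reduction `D_A ⊗_{A,π_A} E` along the augmentation is ISOMORPHIC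
to `D ⊗_E E` (the pair `(D_A, π)` of loc. cit., `π` inducing `D_A ⊗_A L ≅ D`, with `π` forgotten
up to isomorphism). [cite: BellaicheChenevier2009, §2.3.5 (arXiv:math/0602340 numbering)] -/
def deformationsOver (πA : A →ₐ[E] E) {n : ℕ} (D : FramedPhiGammaModule 𝓣.ring n) :
    Set (FramedPhiGammaModule (𝓣.ring.baseChange A) n) :=
  {DA | 𝓣.IsCyclotomicOver A DA ∧ 𝓣.IsContinuousOver A DA ∧ (DA.mapCoeff πA).IsIso (D.baseChange E)}

/-- Membership in `deformationsOver`. [folklore] -/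
lemma mem_deformationsOver_iff (πA : A →ₐ[E] E) {n : ℕ} (D : FramedPhiGammaModule 𝓣.ring n)
    (DA : FramedPhiGammaModule (𝓣.ring.baseChange A) n) :
    DA ∈ 𝓣.deformationsOver A πA D ↔
      𝓣.IsCyclotomicOver A DA ∧ 𝓣.IsContinuousOver A DA ∧ (DA.mapCoeff πA).IsIso (D.baseChange E) :=
  Iff.rfl

/-- `deformationsOver` only depends on the isomorphism class of `D`. [folklore] -/
lemma deformationsOver_congr (πA : A →ₐ[E] E) {n : ℕ} {D D' : FramedPhiGammaModule 𝓣.ring n}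
    (h : D.IsIso D') : 𝓣.deformationsOver A πA D = 𝓣.deformationsOver A πA D' := by
  ext DA
  simp only [mem_deformationsOver_iff]
  exact and_congr_right fun _ => and_congr_right fun _ =>
    ⟨fun hD => hD.trans (h.baseChange E), fun hD' => hD'.trans (h.baseChange E).symm⟩

end OverA

/-! ## Part 3. The datum `D_rig` over finite local `E`-algebras and its predicates -/

/-- **`D_rig` over finite local `E`-algebras** (datum on top of `𝓣 : PhiGammaModuleRobba p F E`):
for every finite-dimensional local `E`-algebra `A` (Artinian; `A = E[ε]/ε²`, `E[X]/X^{m+1}`, …)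
carrying its canonical `E`-module (Banach) topology, a rule
`DrigOver A : FramedGaloisRep F A n → FramedPhiGammaModule (𝓣.ring.baseChange A) n` — INTENDED:
Berger's `D_rig^†(V_A) = (B_rig^† ⊗ V_A)^{H_F}` of the `A`-linear continuous representation
`V_A = Aⁿ`, i.e. `D_rig(Res_{A/E} V_A)` with its `A`-action, a `(φ, Γ_F)`-module over the relative
Robba ring `𝓡_A(π_F) = A ⊗_E 𝓡_E(π_F)`, free of rank `n` because `V_A` is free
[cite: BellaicheChenevier2009, Lemma 2.2.7 (arXiv:math/0602340 numbering)], in a chosen basis.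
A further datum (no theorem is a field): the theorems of the source about the genuine rule are
the predicates `IsFunctorial` and `HasBCEquivalence`.
[cite: BellaicheChenevier2009, Prop. 2.2.6 (i) (arXiv:math/0602340 numbering)],
[cite: KedlayaPottharstXiao2014, Thm. 2.2.17] -/
structure DrigArtinian where
  /-- `D_rig(V_A)` in a chosen `𝓡_A(π_F)`-basis, for `ρ_A : Γ_F^abs →ₜ* GL_n(A)`, `A` a finite local
  `E`-algebra with its `E`-module topology. -/
  DrigOver : (A : Type v) → [CommRing A] → [Algebra E A] → [IsLocalRing A] → [Module.Finite E A] →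
    [TopologicalSpace A] → [IsTopologicalRing A] → [IsModuleTopology E A] →
    {n : ℕ} → FramedGaloisRep F A n → FramedPhiGammaModule (𝓣.ring.baseChange A) n

namespace DrigArtinian

variable {𝓣}

/-- **Functoriality of `D_rig` over finite local coefficient algebras** (a predicate ON the datum
`𝓓`, nothing asserted; binder explicit for the fact census):
(1) over `A = E`, `DrigOver E ρ` is `Drig ρ` up to the identification `𝓡_E = E ⊗_E 𝓡`
(`FramedPhiGammaModule.baseChange E`) and isomorphism;
(2) `D_rig` **commutes with base change in `A`**: along a continuous `E`-algebra map `σ : A → B`,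
`DrigOver B (σ ∘ ρ_A) ≅ (DrigOver A ρ_A) ⊗_{A,σ} B` [cite: KedlayaPottharstXiao2014, Thm. 2.2.17],
(`D_rig(V) ⊗_A M ≅ D_rig(V ⊗_A M)`, [cite: BellaicheChenevier2009, Lemma 2.2.7, proof (arXiv:math/0602340 numbering)]);
(3) `D_rig` is a functor: a change of frame of `ρ_A` changes `DrigOver A ρ_A` by a change of
basis (as `PhiGammaModuleData.Drig_conj`);
(4) `DrigOver A ρ_A` is a `(φ, Γ_F)`-module over `𝓡_A(π_F)`: `H_F` acts trivially and the action
of `Γ_F^abs` is continuous [cite: BellaicheChenevier2009, Def. 2.2.1 and Prop. 2.2.6 (i) (arXiv:math/0602340 numbering)],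
[cite: KedlayaPottharstXiao2014, Def. 2.2.12, Thm. 2.2.17]. -/
def IsFunctorial (𝓓 : 𝓣.DrigArtinian) : Prop :=
  (∀ (n : ℕ) (ρ : FramedGaloisRep F E n), (𝓓.DrigOver E ρ).IsIso ((𝓣.Drig ρ).baseChange E)) ∧
  (∀ (A : Type v) [CommRing A] [Algebra E A] [IsLocalRing A] [Module.Finite E A]
      [TopologicalSpace A] [IsTopologicalRing A] [IsModuleTopology E A]
      (B : Type v) [CommRing B] [Algebra E B] [IsLocalRing B] [Module.Finite E B]
      [TopologicalSpace B] [IsTopologicalRing B] [IsModuleTopology E B]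
      (σ : A →ₐ[E] B) (hσ : Continuous σ) (n : ℕ) (ρA : FramedGaloisRep F A n),
      (𝓓.DrigOver B (ρA.baseChange (σ : A →+* B) hσ)).IsIso ((𝓓.DrigOver A ρA).mapCoeff σ)) ∧
  (∀ (A : Type v) [CommRing A] [Algebra E A] [IsLocalRing A] [Module.Finite E A]
      [TopologicalSpace A] [IsTopologicalRing A] [IsModuleTopology E A]
      (n : ℕ) (g : GL (Fin n) A) (ρA : FramedGaloisRep F A n),
      (𝓓.DrigOver A ρA).IsIso (𝓓.DrigOver A (FramedRep.conj g ρA))) ∧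
  ∀ (A : Type v) [CommRing A] [Algebra E A] [IsLocalRing A] [Module.Finite E A]
      [TopologicalSpace A] [IsTopologicalRing A] [IsModuleTopology E A]
      (n : ℕ) (ρA : FramedGaloisRep F A n),
      𝓣.IsCyclotomicOver A (𝓓.DrigOver A ρA) ∧ 𝓣.IsContinuousOver A (𝓓.DrigOver A ρA)

/-- **The Bellaïche–Chenevier equivalence "deformations of `V` = deformations of the étale
`D = D_rig(V)`"** (a predicate ON the datum `𝓓`, nothing asserted; binder explicit for the fact
census), on framed representatives and up to conjugacy / isomorphism:
(i) `D_rig` is fully faithful over `A` on isomorphism classes — representations over `A` with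
isomorphic `(φ, Γ_F)`-modules over `𝓡_A(π_F)` differ by a change of frame
[cite: BellaicheChenevier2009, Prop. 2.2.6 (i) (arXiv:math/0602340 numbering)],
[cite: KedlayaPottharstXiao2014, Thm. 2.2.17] (this makes `X_V(A) → X_D(A)` injective);
(ii) every framed `(φ, Γ_F)`-module `D_A` over `𝓡_A(π_F)` deforming `D_rig(ρ)` to `(A, π_A)`
(`PhiGammaModuleRobba.deformationsOver`: `H_F` trivial, `Γ_F` continuous, reduction along `π_A`
isomorphic to `D_rig(ρ)`) is isomorphic over `𝓡_A(π_F)` to `DrigOver A ρ_A` for some framed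
deformation `ρ_A` of `ρ` (`FramedGaloisRep.deformationsOver`: reduction EQUAL to `ρ`) — the
surjectivity of `X_V(A) → X_D(A)`: "`D_A` is a successive extension of `D`, hence étale, so
`D_A = D_rig(V_A)` with `V_A` free over `A`" (Lemma 2.2.5, Prop. 2.2.6 (i), Lemma 2.2.7 of the
source).  Printed for `F = ℚ_p`; see the module docstring for `F ≠ ℚ_p`.
[cite: BellaicheChenevier2009, Prop. 2.3.12 (arXiv:math/0602340 numbering)] -/
def HasBCEquivalence (𝓓 : 𝓣.DrigArtinian) : Prop :=
  (∀ (A : Type v) [CommRing A] [Algebra E A] [IsLocalRing A] [Module.Finite E A]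
      [TopologicalSpace A] [IsTopologicalRing A] [IsModuleTopology E A]
      (n : ℕ) (ρA ρA' : FramedGaloisRep F A n),
      (𝓓.DrigOver A ρA).IsIso (𝓓.DrigOver A ρA') → ∃ g : GL (Fin n) A, ρA' = FramedRep.conj g ρA) ∧
  ∀ (A : Type v) [CommRing A] [Algebra E A] [IsLocalRing A] [Module.Finite E A]
      [TopologicalSpace A] [IsTopologicalRing A] [IsModuleTopology E A]
      (πA : A →ₐ[E] E) (n : ℕ) (ρ : FramedGaloisRep F E n)
      (DA : FramedPhiGammaModule (𝓣.ring.baseChange A) n),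
      DA ∈ 𝓣.deformationsOver A πA (𝓣.Drig ρ) →
        ∃ ρA ∈ FramedGaloisRep.deformationsOver A πA ρ, (𝓓.DrigOver A ρA).IsIso DA

variable (𝓓 : 𝓣.DrigArtinian)

section Consequences

variable {A : Type v} [CommRing A] [Algebra E A] [IsLocalRing A] [Module.Finite E A]
  [TopologicalSpace A] [IsTopologicalRing A] [IsModuleTopology E A]

/-- **`D_rig` maps deformations of `ρ` to deformations of `D_rig(ρ)`** (the well-definedness of
`X_V(A) → X_D(A)`, from functoriality): if `ρ_A` reduces to `ρ` along `π_A`, then `DrigOver A ρ_A`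
is a `(φ, Γ_F)`-module over `𝓡_A(π_F)` whose reduction along `π_A` is
`≅ DrigOver E ρ ≅ D_rig(ρ) ⊗_E E`. [cite: BellaicheChenevier2009, §2.3.6 (arXiv:math/0602340 numbering)] -/
theorem IsFunctorial.drigOver_mem_deformationsOver (h : 𝓓.IsFunctorial) (πA : A →ₐ[E] E) {n : ℕ}
    {ρ : FramedGaloisRep F E n} {ρA : FramedGaloisRep F A n}
    (hρA : ρA ∈ FramedGaloisRep.deformationsOver A πA ρ) :
    𝓓.DrigOver A ρA ∈ 𝓣.deformationsOver A πA (𝓣.Drig ρ) := by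
  obtain ⟨h1, h2, -, h4⟩ := h
  refine ⟨(h4 A n ρA).1, (h4 A n ρA).2, ?_⟩
  have hred := h2 A E πA (IsModuleTopology.continuous_of_linearMap πA.toLinearMap) n ρA
  rw [hρA] at hred
  exact hred.symm.trans (h1 n ρ)

/-- Under functoriality, conjugate deformations have isomorphic `(φ, Γ_F)`-modules, so `DrigOver`
descends to conjugacy classes of framed deformations. [folklore] -/
theorem IsFunctorial.isIso_drigOver_conj (h : 𝓓.IsFunctorial) {n : ℕ} (g : GL (Fin n) A)
    (ρA : FramedGaloisRep F A n) :
    (𝓓.DrigOver A ρA).IsIso (𝓓.DrigOver A (FramedRep.conj g ρA)) :=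
  h.2.2.1 A n g ρA

/-- Under `HasBCEquivalence`, deformations of `ρ` with isomorphic `(φ, Γ_F)`-modules over
`𝓡_A(π_F)` are conjugate (injectivity of `X_V(A) → X_D(A)` on the coarse classes). [folklore] -/
theorem HasBCEquivalence.exists_conj_of_isIso (h : 𝓓.HasBCEquivalence) {n : ℕ}
    {ρA ρA' : FramedGaloisRep F A n} (hiso : (𝓓.DrigOver A ρA).IsIso (𝓓.DrigOver A ρA')) :
    ∃ g : GL (Fin n) A, ρA' = FramedRep.conj g ρA :=
  h.1 A n ρA ρA' hiso

/-- Under `HasBCEquivalence`, every `(φ, Γ_F)`-module over `𝓡_A(π_F)` deforming `D_rig(ρ)` is the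
`D_rig` of a deformation of `ρ` (surjectivity of `X_V(A) → X_D(A)`).
[cite: BellaicheChenevier2009, Prop. 2.3.12 (arXiv:math/0602340 numbering)] -/
theorem HasBCEquivalence.exists_isIso_drigOver (h : 𝓓.HasBCEquivalence) (πA : A →ₐ[E] E) {n : ℕ}
    (ρ : FramedGaloisRep F E n) {DA : FramedPhiGammaModule (𝓣.ring.baseChange A) n}
    (hDA : DA ∈ 𝓣.deformationsOver A πA (𝓣.Drig ρ)) :
    ∃ ρA ∈ FramedGaloisRep.deformationsOver A πA ρ, (𝓓.DrigOver A ρA).IsIso DA :=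
  h.2 A πA n ρ DA hDA

end Consequences

end DrigArtinian

end PhiGammaModuleRobba

/-! ## Part 4. First-order coefficients: the dual numbers `E[ε]` qualify

The coefficient algebra of the Colmez–Greenberg–Stevens formula is `A = E[ε]/ε²`
[cite: Ding2019SimpleL, §3.3], Mathlib's `DualNumber E = TrivSqZeroExt E E`, which Mathlib knows to
be a local ring (`DualNumber.instIsLocalRing`) and a topological ring (product topology); the two
remaining instance arguments of `DrigArtinian.DrigOver` are supplied here (as theorems, to be
introduced with `haveI`; no global instances on Mathlib types are registered), together with the
augmentation `TrivSqZeroExt.fstHom E E E : E[ε] →ₐ[E] E`. -/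

section DualNumber

variable (E)

omit [TopologicalSpace E] [IsTopologicalRing E] in
/-- `E[ε] = E ⊕ E·ε` is a finite `E`-module (it is `E × E`). [folklore] -/
theorem moduleFinite_dualNumber : Module.Finite E (DualNumber E) :=
  inferInstanceAs (Module.Finite E (E × E))

/-- The topology of `E[ε]` (Mathlib's product topology on `TrivSqZeroExt E E`) is its `E`-module
topology, i.e. the canonical Banach topology of the finite `E`-algebra `E[ε]`. [folklore] -/
theorem isModuleTopology_dualNumber : IsModuleTopology E (DualNumber E) :=
  inferInstanceAs (IsModuleTopology E (E × E))

variable {E}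

/-- **`D_rig` of a first-order deformation** `ρ_ε : Γ_F^abs →ₜ* GL_n(E[ε])`: the value of the datum
over `A = E[ε]` (instances from `moduleFinite_dualNumber`, `isModuleTopology_dualNumber`), a framed
`(φ, Γ_F)`-module over `𝓡_{E[ε]}(π_F) = E[ε] ⊗_E 𝓡_E(π_F)` — the object entering the
Colmez–Greenberg–Stevens formula. [cite: Ding2019SimpleL, §3.3],
[cite: BellaicheChenevier2009, Prop. 2.3.12 (arXiv:math/0602340 numbering)] -/
abbrev PhiGammaModuleRobba.DrigArtinian.drigOverDualNumber {𝓣 : PhiGammaModuleRobba.{u, v, w} p F E}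
    (𝓓 : 𝓣.DrigArtinian) {n : ℕ} (ρε : FramedGaloisRep F (DualNumber E) n) :
    FramedPhiGammaModule (𝓣.ring.baseChange (DualNumber E)) n :=
  haveI := moduleFinite_dualNumber E
  haveI := isModuleTopology_dualNumber E
  𝓓.DrigOver (DualNumber E) ρε

omit [TopologicalSpace F] in
/-- The reduction modulo `ε` of a first-order deformation `ρ_ε` of `ρ` (a member of
`FramedGaloisRep.deformationsOver E[ε] fstHom ρ`) is `ρ`; unfolding lemma for that membership.
[folklore] -/
lemma FramedGaloisRep.mem_deformationsOver_dualNumber_iff {n : ℕ} (ρ : FramedGaloisRep F E n)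
    (ρε : FramedGaloisRep F (DualNumber E) n) :
    haveI := isModuleTopology_dualNumber E
    ρε ∈ FramedGaloisRep.deformationsOver (DualNumber E) (TrivSqZeroExt.fstHom E E E) ρ ↔
      ∀ (σ : absoluteGaloisGroup F) (i j : Fin n),
        TrivSqZeroExt.fst ((ρε σ : GL (Fin n) (DualNumber E)) i j) = (ρ σ : GL (Fin n) E) i j := by
  haveI := isModuleTopology_dualNumber E
  rw [FramedGaloisRep.mem_deformationsOver_iff]
  constructor
  · intro h σ i j
    rw [← h]
    rfl
  · intro h
    refine ContinuousMonoidHom.ext fun σ => ?_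
    ext i j
    exact h σ i j

end DualNumber

end Robba

end Literature.NumberTheory.GaloisRepresentations

end
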